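import Summits.MatrixMultiplication.OmegaCensus.STPP211Z2pow6NFMapsB

/-!
# (2,1,1)¹⁰ ⊄ (ℤ/2)⁶ — part H1c: the GL normal-form maps of `𝔽₂⁶` (kernel-checked), for the normal-form layer (S3)

Cell `pub-omega` (unit `pub-omega-stpp-1-g36`), topic `Summits/MatrixMultiplication/OmegaCensus`.
HONEST FRAMING (verbatim): lottery ticket; floor = certified bounds/negative ranges. Census STRUCTURE bookkeeping (B5, `T1((ℤ/2)⁶)`, Pb237);
nothing here is a bound on `ω`.

Twin of the `𝔽₂⁵` maps of `STPP211Z2pow5Codes` (seat g35) one dimension up. `u j = dec 2ʲ` (`j < 6`) is the standard basis;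
`phi j v : G6 →+ G6` (any `v`) is additive and injective, and when `2ʲ ≤ enc v` it sends `v ↦ u j` and FIXES every `x` with `enc x < 2ʲ`
(the span of `u 0 … u (j−1)`). On codes (`phiC`): with `i` the top bit of `w = enc v`, `x ↦ swapᵢⱼ(x + xᵢ w) + xᵢ 2ʲ`. The four properties
are `decide`d by the kernel over the `64³` code triples, one theorem per `j` (`phiC_check0 … phiC_check5`). These maps drive the GL descent
of an arbitrary `c`-set `C ∋ 0` to a FRAME NORMAL FORM `{0, u 0, …, u (d−1)} ⊆ C ⊆ span` (`d = dim span C`), the first stage of the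
reduction «any `(2,1,1)¹⁰` family of `(ℤ/2)⁶` ↦ one of the 29 representative `c`-lists» (successor files).

References: H. Cohn, R. Kleinberg, B. Szegedy, C. Umans, FOCS 2005 (arXiv:math/0511460), Def. 5.1.
-/

namespace Summit.MatrixMultiplication.OmegaCensus

namespace T1Z2p6

open Finset

/-- KERNEL CHECK, `j = 4` (64³ code triples). -/
theorem phiC_check4 : phiCheck 4 = true := by decide +kernel
/-- KERNEL CHECK, `j = 5`. -/
theorem phiC_check5 : phiCheck 5 = true := by decide +kernel

end T1Z2p6

end Summit.MatrixMultiplication.OmegaCensus
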